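import Summits.Ventures.HSemireg.WedgeHankelSubstitutionSiegel
import Summits.Ventures.HSemireg.WedgeHankelFrameIntersection
import Summits.Ventures.HSemireg.WedgeHankelDivisorRank

/-!
# Venture HSemireg — TOP-DEGREE TORELLI: the degree-`n` kernel of th-7's class is the annihilator of the LINE it spans, so it determines the class up to ONE scalar;
# for a divisor class it determines the WEIGHTS up to one common scalar — the mirror-range kernel «depends on the class», sharpest form

HONEST FRAMING. Part of the Lean index of the computation cell `pub-hsemireg` (seat p10 gen 18, Sunday typer «UNIFORM-IN-n»).
Finite-dimensional EXTERIOR ALGEBRA over a field ONLY: no variety, no cohomology theory, no sheaf, no Ext group, no semiregularity map;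
nothing here says that HC / HC_CM / HC_AV holds; no Literature fact is declared or used.  Custodian versions as in `WedgeHankelSiegelIdeal` (1/3) and `WedgeKernelDuality`;
the dictionary (`v = Σ_j q_j Θ^j/j!` ↦ `w_n(q)`; `θ ↦ θ ∧ w_n(q)` on `⋀^n K^{2n}` ↦ `⌟v` on the middle degree) is QUOTED, never asserted.

WHAT IS IN THE TREE.  E1 `Kr_w_eq_Ann` (`Kr(univ, w_n q, k) = Ann_k(V(univ, w_n q, n−k))`), `Ann_Ann` (double annihilator), G3 `V_univ_zero` (`V(univ, f, 0) = K∙f`), F2a `expMul_sum_eq_zero`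
(independence of confluent exponential sequences on the window `[0, D)`), H1b `w_eq_w_iff` (the class determines its window).  G9's header and READ-NOTE-g17 §E left: «a NAME for the
class kernel in the mirror range `n + 1 − k ≤ D ≤ k + 1` — it depends on the class, not only on the divisor (`Ann_k(⋀^{n−k} ∧ class)`)».  THIS FILE makes the dependence EXACT in the top
degree `k = n` (the one mirror degree every non-zero class of total order `≤ n + 1` is in; namespace `Summit.Ventures.HSemireg.Wedge.KernelDuality` continued):
* §134 **`Kr_w_top_eq_Ann_span`: `Kr(univ, w_n q, n) = Ann_n(K ∙ w_n q)`** — the top kernel is the annihilator of a line (a hyperplane of `⋀^n` when `w_n q ≠ 0`: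
  `finrank_Kr_w_top_add_one`).
* §135 **TOP-DEGREE TORELLI `Kr_w_top_eq_iff`: `Kr(univ, w_n q, n) = Kr(univ, w_n q′, n) ↔ K ∙ w_n q = K ∙ w_n q′`** (double annihilator), and in coefficients
  **`Kr_w_top_eq_iff_exists_mul`**: for `q ≢ 0` on `[0, n]`, equal top kernels iff `q′ = c·q` on `[0, n]` for ONE `c ≠ 0` (H1b `w_eq_w_iff`).
* §136 DIVISOR CLASSES: **`expMul_sum_window_eq_iff`** (the weights of a divisor class of total order `D ≤ n + 1` are determined by its window — F2a's independence restated) and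
  **`Kr_w_top_expMul_sum_eq_iff`**: two divisor classes on the SAME distinct nodes with supports `[0, P_i]`, `D = Σ_i (P_i+1) ≤ n + 1`, the first of exact orders, have the same
  degree-`n` kernel IFF their weight sequences are PROPORTIONAL by one common non-zero scalar — the top kernel sees everything about the class but that scalar, so in particular
  two classes with the same divisor and non-proportional weights have DIFFERENT top kernels (`Kr_w_top_ne_of_not_prop`).
NOT typed here: the intermediate mirror degrees `n/2 < k < n` (there the kernel is `Ann_k(w ∧ ⋀^{n−k})`, E1; whether it determines the class is not settled here — for `n = 2`, `k = 1`,
`D = 2` it is `0` for every class); anything Ext-side.  Class side only; new names only.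
-/

open Module

namespace Summit.Ventures.HSemireg.Wedge.KernelDuality

open Summit.Ventures.HSemireg.Wedge Summit.Ventures.HSemireg.Wedge.Kunneth Summit.Ventures.HSemireg.Wedge.Hankel
  Summit.Ventures.HSemireg.Wedge.HankelSiegel Summit.Ventures.HSemireg.Wedge.HankelSiegelIdeal Summit.Ventures.HSemireg.Wedge.KunnethKernel
  Summit.Ventures.HSemireg.Wedge.HankelFrameChange Summit.Ventures.HSemireg.Wedge.HankelRankOne

variable (K : Type*) [Field K] {n : ℕ}

/-! ## §134. The top kernel is the annihilator of a line -/

/-- **`Kr(univ, w_n(q), n) = Ann_n(K ∙ w_n(q))`**: the degree-`n` kernel of a class is the annihilator of the line it spans (E1 with `k′ = 0`, `V(univ, f, 0) = K∙f`). -/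
theorem Kr_w_top_eq_Ann_span (q : ℕ → K) : Kr K Finset.univ (w K n n q) n = Ann K n (K ∙ w K n n q) := by
  rw [Kr_w_eq_Ann K (k' := 0) (Nat.add_zero n) q, V_univ_zero]

/-- the line of a class lies in `Hom(univ, n)`. -/
lemma span_w_le_Hom (q : ℕ → K) : (K ∙ w K n n q) ≤ Hom K (In n) Finset.univ n :=
  (Submodule.span_singleton_le_iff_mem _ _).mpr (w_top_mem_Hom K q)

/-- **the top kernel of a NON-ZERO class is a hyperplane of `⋀^n`**: `dim Kr(univ, w_n q, n) + 1 = C(2n, n)`. -/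
theorem finrank_Kr_w_top_add_one {q : ℕ → K} (hq : w K n n q ≠ 0) : finrank K (Kr K Finset.univ (w K n n q) n) + 1 = (n + n).choose n := by
  rw [Kr_w_top_eq_Ann_span, ← finrank_span_singleton (K := K) hq]
  have h := finrank_Ann_add K (a := n) (b := n) (I := In n) (by rw [Fintype.card_fin]) (span_w_le_Hom K q)
  rwa [Fintype.card_fin] at h

/-! ## §135. Top-degree Torelli -/

/-- **TOP-DEGREE TORELLI: `Kr(univ, w_n q, n) = Kr(univ, w_n q′, n) ↔ K ∙ w_n q = K ∙ w_n q′`** — the top kernel determines the class up to a scalar (double annihilator). -/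
theorem Kr_w_top_eq_iff (q q' : ℕ → K) : Kr K Finset.univ (w K n n q) n = Kr K Finset.univ (w K n n q') n ↔ (K ∙ w K n n q) = K ∙ w K n n q' := by
  rw [Kr_w_top_eq_Ann_span, Kr_w_top_eq_Ann_span]
  refine ⟨fun h => ?_, fun h => by rw [h]⟩
  have hc : n + n = Fintype.card (In n) := by rw [Fintype.card_fin]
  rw [← Ann_Ann K hc (span_w_le_Hom K q), ← Ann_Ann K hc (span_w_le_Hom K q'), h]

/-- a class vanishes iff its window does. -/
lemma w_eq_zero_iff (q : ℕ → K) : w K n n q = 0 ↔ ∀ j ≤ n, q j = 0 := by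
  rw [← w_zero K (n := n) n]
  exact w_eq_w_iff K q fun _ => 0

/-- **… IN COEFFICIENTS: for `q ≢ 0` on `[0, n]`, `Kr(univ, w_n q, n) = Kr(univ, w_n q′, n)` iff `q′ = c·q` on `[0, n]` for ONE non-zero scalar `c`** (H1b `w_eq_w_iff`). -/
theorem Kr_w_top_eq_iff_exists_mul {q q' : ℕ → K} (hq : ∃ j ≤ n, q j ≠ 0) :
    Kr K Finset.univ (w K n n q) n = Kr K Finset.univ (w K n n q') n ↔ ∃ c : K, c ≠ 0 ∧ ∀ j ≤ n, q' j = c * q j := by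
  have hw : w K n n q ≠ 0 := fun h0 => by
    obtain ⟨j, hj, hne⟩ := hq
    exact hne ((w_eq_zero_iff K q).mp h0 j hj)
  rw [Kr_w_top_eq_iff]
  constructor
  · intro h
    have hmem : w K n n q' ∈ K ∙ w K n n q := h ▸ Submodule.mem_span_singleton_self _
    obtain ⟨c, hc⟩ := Submodule.mem_span_singleton.mp hmem
    refine ⟨c, ?_, fun j hj => ?_⟩
    · rintro rfl
      rw [zero_smul] at hc
      apply hw
      have hbot : (K ∙ w K n n q) = ⊥ := by rw [h, ← hc, Submodule.span_singleton_eq_bot]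
      exact (Submodule.span_singleton_eq_bot.mp hbot)
    · have e : w K n n q' = w K n n (fun i => c * q i) := by rw [w_smul, hc]
      exact (w_eq_w_iff K _ _).mp e j hj
  · rintro ⟨c, hc, h⟩
    have e : w K n n q' = c • w K n n q := by
      rw [← w_smul]; exact w_eq_of_agree K n fun j hj => h j hj
    rw [e, Submodule.span_singleton_smul_eq (isUnit_iff_ne_zero.mpr hc)]

/-! ## §136. Divisor classes: the top kernel sees the weights up to one common scalar -/

/-- **THE WEIGHTS OF A DIVISOR CLASS ARE DETERMINED BY ITS WINDOW** (F2a's independence restated): distinct nodes, `q_i, q′_i` supported on `[0, P_i]`, `Σ_i (P_i + 1) ≤ n + 1`;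
`Σ_i expMul λ_i q_i = Σ_i expMul λ_i q′_i` on `[0, n]` iff `q_i = q′_i` for every `i`. -/
theorem expMul_sum_window_eq_iff {r : ℕ} {lam : Fin r → K} (hlam : Function.Injective lam) {P : Fin r → ℕ} {q q' : Fin r → ℕ → K}
    (hq : ∀ i j, P i < j → q i j = 0) (hq' : ∀ i j, P i < j → q' i j = 0) (hD : ∑ i, (P i + 1) ≤ n + 1) :
    (∀ j ≤ n, ∑ i, expMul K (lam i) (q i) j = ∑ i, expMul K (lam i) (q' i) j) ↔ ∀ i j, q i j = q' i j := by
  refine ⟨fun h i j => ?_, fun h j _ => Finset.sum_congr rfl fun i _ => by rw [show q i = q' i from funext (h i)]⟩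
  have hz := expMul_sum_eq_zero K hlam (∑ i, (P i + 1)) (fun i => P i + 1) (fun i t => q i t - q' i t) rfl
    (fun i t ht => by rw [hq i t (by omega), hq' i t (by omega), sub_zero])
    (fun t ht => by
      have e : ∀ i, expMul K (lam i) (fun s => q i s - q' i s) t = expMul K (lam i) (q i) t - expMul K (lam i) (q' i) t := fun i => by
        rw [expMul_eq_sum, expMul_eq_sum, expMul_eq_sum, ← Finset.sum_sub_distrib]
        exact Finset.sum_congr rfl fun _ _ => by ring
      rw [Finset.sum_congr rfl fun i _ => e i, Finset.sum_sub_distrib, h t (by omega), sub_self])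
  exact sub_eq_zero.mp (hz i j)

/-- **TOP-DEGREE TORELLI FOR DIVISOR CLASSES**: same distinct nodes `λ_i`, supports `[0, P_i]` with `Σ_i (P_i+1) ≤ n + 1`, the first class of exact orders (`q_i(P_i) ≠ 0`, `r > 0`):
`Kr(univ, w_n(Σ_i expMul λ_i q_i), n) = Kr(univ, w_n(Σ_i expMul λ_i q′_i), n)` **iff the weights are proportional by ONE common non-zero scalar**: `∃ c ≠ 0, q′_i = c·q_i ∀ i`.
The mirror-range kernel depends on the class, and in the top degree on nothing less than the class up to a scalar. -/
theorem Kr_w_top_expMul_sum_eq_iff {r : ℕ} (hr : 0 < r) {lam : Fin r → K} (hlam : Function.Injective lam) {P : Fin r → ℕ} {q q' : Fin r → ℕ → K}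
    (hq : ∀ i j, P i < j → q i j = 0) (hqP : ∀ i, q i (P i) ≠ 0) (hq' : ∀ i j, P i < j → q' i j = 0) (hD : ∑ i, (P i + 1) ≤ n + 1) :
    Kr K Finset.univ (w K n n (fun j => ∑ i, expMul K (lam i) (q i) j)) n = Kr K Finset.univ (w K n n (fun j => ∑ i, expMul K (lam i) (q' i) j)) n ↔
      ∃ c : K, c ≠ 0 ∧ ∀ i j, q' i j = c * q i j := by
  -- the first class is non-zero on the window (else all its weights vanish, F2a)
  have hne : ∃ j ≤ n, (∑ i, expMul K (lam i) (q i) j) ≠ 0 := by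
    by_contra hall
    simp only [not_exists, not_and, not_not] at hall
    have hz := (expMul_sum_window_eq_iff K hlam hq (q' := fun _ _ => 0) (fun _ _ _ => rfl) hD).mp (fun j hj => by
      rw [hall j hj]; exact (Finset.sum_eq_zero fun i _ => by rw [expMul_eq_sum]; exact Finset.sum_eq_zero fun _ _ => by rw [mul_zero]).symm)
    exact hqP ⟨0, hr⟩ (hz ⟨0, hr⟩ (P ⟨0, hr⟩))
  rw [Kr_w_top_eq_iff_exists_mul K hne]
  constructor
  · rintro ⟨c, hc, h⟩
    refine ⟨c, hc, ?_⟩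
    have h' : ∀ j ≤ n, ∑ i, expMul K (lam i) (q' i) j = ∑ i, expMul K (lam i) (fun t => c * q i t) j := fun j hj => by
      rw [h j hj, Finset.mul_sum]
      exact Finset.sum_congr rfl fun i _ => (expMul_smul K (lam i) c (q i) j).symm
    have := (expMul_sum_window_eq_iff K hlam hq' (q' := fun i t => c * q i t) (fun i t ht => by rw [hq i t ht, mul_zero]) hD).mp h'
    exact fun i j => this i j
  · rintro ⟨c, hc, h⟩
    refine ⟨c, hc, fun j _ => ?_⟩
    rw [Finset.mul_sum]
    exact Finset.sum_congr rfl fun i _ => by rw [show q' i = fun t => c * q i t from funext (h i), expMul_smul]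

/-- in particular **two classes with the same divisor and NON-PROPORTIONAL weights have different top kernels.** -/
theorem Kr_w_top_ne_of_not_prop {r : ℕ} (hr : 0 < r) {lam : Fin r → K} (hlam : Function.Injective lam) {P : Fin r → ℕ} {q q' : Fin r → ℕ → K}
    (hq : ∀ i j, P i < j → q i j = 0) (hqP : ∀ i, q i (P i) ≠ 0) (hq' : ∀ i j, P i < j → q' i j = 0) (hD : ∑ i, (P i + 1) ≤ n + 1)
    (hnp : ∀ c : K, c ≠ 0 → ∃ i j, q' i j ≠ c * q i j) :
    Kr K Finset.univ (w K n n (fun j => ∑ i, expMul K (lam i) (q i) j)) n ≠ Kr K Finset.univ (w K n n (fun j => ∑ i, expMul K (lam i) (q' i) j)) n := by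
  intro h
  obtain ⟨c, hc, hcq⟩ := (Kr_w_top_expMul_sum_eq_iff K hr hlam hq hqP hq' hD).mp h
  obtain ⟨i, j, hij⟩ := hnp c hc
  exact hij (hcq i j)

end Summit.Ventures.HSemireg.Wedge.KernelDuality
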